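import Mathlib
import HarnessLib
import Literature.Combinatorics.Additive.OneHoleProgressionSums
import Literature.Combinatorics.Additive.TwoComponentTransfer

/-!
# Grynkiewicz 2009, Lemma 5.10: transfer from a progression with one hole

[cite: Grynkiewicz2009, Lemma 5.10] [tag: critical-pair] [tag: inverse-theorem]

Topic `Literature/Combinatorics/Additive`.  Cell `mm-stpp` (D-0046), seat `mm-stpp-lit` (gen 23); the
port of D. J. Grynkiewicz, *A step beyond Kemperman's structure theorem*, Mathematika **55** (2009)
67–114, continued: **Lemma 5.10** (arXiv:0710.1041v2 Lemma 4.14), «The next lemma stretches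
Lemma 5.8 one step further, to handle the case `d⊆(A, 𝒜𝒫) = 1`».  The counting core (normalised
position) is `OneHoleProgressionSums.lean`; this file performs the reductions of the printed proof
and assembles the lemma.

SOURCE (print pp. 21–22 = p0021–p0022 of the held text `paper:doi-10-1112-s0025579300000966`, read
2026-08-29).  «**Lemma 5.10.** Let `A` and `B` be nonempty subsets of a finite abelian group `G` with
`|A + B| = |A| + |B|`, `0 ∈ A ∩ B`, `|A|, |B|, d⊆(A + B, 𝒫) ≥ 3`, and `(A, B)` non-extendible,
`⟨A⟩ = G` and `A` not quasi-periodic.  If `d⊆(A, 𝒜𝒫_d) = 1` for some nonzero `d ∈ G`, and if at most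
one of `|A|`, `|B|` and `|\overline{A + B}|` is equal to `3`, then (17) holds and one of
`d⊆(B, 𝒬𝒜𝒫_d) ≤ 1` or `d⊆(B, 𝒬𝒜𝒫_{d'}) = 0`, for some non-zero `d'`, or `d⊆(C, 𝒬𝒫) = 1`, for all
`C ∈ {A, B, A + B, Ā, B̄, \overline{A + B}}`, also holds.»  Conventions as in the ports of Lemmas
5.6–5.9: (17) = «`|(A ∪ {α}) + (B ∪ {β})| = |A ∪ {α}| + |B ∪ {β}| − 1` for some `α, β`»,
`d⊆(A + B, 𝒫) ≥ 3` unfolded, `𝒜𝒫_d = {P | IsAP P d}`, `𝒬𝒜𝒫_d = {P | IsQuasiProgression d P}`,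
`𝒬𝒫 = {P | IsQuasiPeriodic P}`.  Of the hypothesis «at most one of `|A|`, `|B|`, `|\overline{A + B}|`
is equal to `3`» the printed proof uses only «`|A| = 3 ⟹ |\overline{A + B}| ≠ 3`» («Thus
`|A| = |\overline{A + B}| = 3`, a contradiction»; its «Since `|B| ≥ 4`, it follows that `x ≤ c − 1`» is
not needed by the count as done in `oneHole_three_gaps`), and only that implication is assumed here.

MAIN RESULTS (0 definitions, 0 named facts; everything PROVED).
* `Grynkiewicz2009.seventeen_of_subsetDist_isAP_eq_one` — **Lemma 5.10**.
* `Grynkiewicz2009.exists_oneHole_normal_form` — «By translating and considering `−A` and `−B` if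
  necessary, we may w.l.o.g. assume `0, d ∈ A`, and that `0` is the first term»: `A ∪ {α}` is
  `{a, a + e, …, a + ℓ e}` with `e = ±d` and the hole `α = a + j e`, `2 ≤ j ≤ ℓ − 1` (reading the
  progression backwards, `Isoperimetric.apFinset_eq_apFinset_neg`, replaces «considering `−A` and
  `−B`»).
* `Grynkiewicz2009.componentCount_oneHole` — «Hence, `c_d(A) = 2`».
* `Grynkiewicz2009.zmultiples_eq_top_of_subset_apFinset` — «since `⟨A⟩ = G`, it follows that
  `⟨d⟩ = G`».
* `Grynkiewicz2009.isQuasiProgression_of_isAP` — an aperiodic progression with difference `e` lies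
  in `𝒬𝒜𝒫_e` (to read Lemma 5.9's alternative `d⊆(B, 𝒜𝒫) = 0` as `d⊆(B, 𝒬𝒜𝒫_{d'}) = 0`).
* (gen 23 append) `Grynkiewicz2009.seventeen_of_subsetDist_quasiProgression_le_one` — §6 display
  (50): «if `d⊆(A, 𝒬𝒜𝒫_d) ≤ 1`, then `d⊆(A, 𝒬𝒫) ≥ 2` implies `d⊆(A, 𝒜𝒫) ≤ 1` … in view of Lemmas 5.8
  and 5.10 … else the proof is complete» ((17) follows); with `subsetDist_isAP_le_one_of_quasiProgression`
  and the unfolding `exists_of_subsetDist_le`.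

PROOF, as printed: `d⊆(A, 𝒜𝒫_d) = 1` gives the one-hole shape and `c_d(A) = 2`; `⟨d⟩ = G`;
`c_d(B) = 1` (`d⊆(B, 𝒬𝒜𝒫_d) = 0`) makes `B` a progression (here by
`Isoperimetric.exists_eq_apFinset_of_card_vadd_sdiff_le_one_of_zmultiples_eq_top`; the print invokes
Lemma 5.4) and Lemma 5.8 (`subsetDist_quasiProgression_of_isAP`) finishes; otherwise, after
normalising (translation by the first term, `e = ±d`), `|A| = 3` gives `c ≤ 3`
(`componentCount_le_of_oneHole`) and `c = 3` is `oneHole_three_gaps`, while `|A| ≥ 4` gives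
`c ≤ 2` by Lemma 5.9 (`componentCount_le_two_or_seventeen_of_componentCount_eq_two`) «else the proof
is complete»; the remaining case `c = 2` is `oneHole_two_gaps`, translated back.

## References
* D. J. Grynkiewicz, *A step beyond Kemperman's structure theorem*, Mathematika 55 (2009) 67–114,
  doi:10.1112/S0025579300000966, Lemma 5.10 (pp. 21–22); arXiv:0710.1041v2 Lemma 4.14
  [cite: Grynkiewicz2009, Lemma 5.10] — held `paper:doi-10-1112-s0025579300000966` /
  `paper:arxiv-0710.1041`.
-/

namespace Literature.Combinatorics.Additive

open Finset
open scoped Pointwise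

universe u

namespace Grynkiewicz2009

variable {G : Type u} [AddCommGroup G] [DecidableEq G]

/-! ### One-hole progressions: erasing an end term, translating, the normal form -/

/-- Erasing the first term of a progression with distinct terms leaves the progression from the
second term. [cite: Grynkiewicz2009, Lemma 5.10 (proof, «A is a subset of an arithmetic
progression with difference d and one hole»)] -/
theorem erase_apFinset_first (a d : G) {n : ℕ} (h : #(apFinset a d (n + 1)) = n + 1) :
    (apFinset a d (n + 1)).erase a = apFinset (a + d) d n := by
  have hsplit : apFinset a d (n + 1) = insert a (apFinset (a + d) d n) := by
    rw [add_comm n 1, apFinset_add_eq_union, apFinset_one, one_nsmul, insert_eq]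
  have hnot : a ∉ apFinset (a + d) d n := fun ha => by
    rw [hsplit, insert_eq_of_mem ha] at h
    have := card_apFinset_le (a + d) d n
    omega
  rw [hsplit, erase_insert hnot]

/-- Erasing the last term of a progression with distinct terms leaves the progression of the first
`n` terms. [cite: Grynkiewicz2009, Lemma 5.10 (proof)] -/
theorem erase_apFinset_last (a d : G) {n : ℕ} (h : #(apFinset a d (n + 1)) = n + 1) :
    (apFinset a d (n + 1)).erase (a + n • d) = apFinset a d n := by
  have hsplit : apFinset a d (n + 1) = insert (a + n • d) (apFinset a d n) := by
    rw [apFinset_add_eq_union, apFinset_one, union_comm, insert_eq]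
  have hnot : a + n • d ∉ apFinset a d n := fun ha => by
    rw [hsplit, insert_eq_of_mem ha] at h
    have := card_apFinset_le a d n
    omega
  rw [hsplit, erase_insert hnot]

/-- Translating an erased finset. [folklore] -/
private theorem vadd_finset_erase' (g : G) (S : Finset G) (y : G) :
    g +ᵥ S.erase y = (g +ᵥ S).erase (g + y) := by
  ext x
  rw [mem_erase, mem_vadd_finset, mem_vadd_finset]
  constructor
  · rintro ⟨z, hz, rfl⟩
    rw [mem_erase] at hz
    exact ⟨fun h => hz.1 (add_left_cancel h), z, hz.2, rfl⟩
  · rintro ⟨hne, z, hz, rfl⟩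
    exact ⟨z, mem_erase.2 ⟨fun h => hne (by rw [h, vadd_eq_add]), hz⟩, rfl⟩

/-- Translating the one-hole progression to first term `0`. [cite: Grynkiewicz2009, Lemma 5.10
(proof, «By translating … we may w.l.o.g. assume 0, d ∈ A»)] -/
theorem neg_vadd_erase_apFinset (a e : G) (n j : ℕ) :
    (-a) +ᵥ (apFinset a e n).erase (a + j • e) = (apFinset (0 : G) e n).erase (j • e) := by
  rw [vadd_finset_erase', vadd_apFinset, neg_add_cancel_left, neg_add_cancel]

/-- **Normal form of a one-hole progression.**  If `A ∪ {α}` (`α ∉ A`) is an arithmetic progression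
with difference `d` having `|A| + 1` distinct terms, `A` itself is not one, and `|A| ≥ 3`, then for
`e = d` or `e = −d`: `A ∪ {α} = {a, a + e, …, a + ℓ e}` (`ℓ = |A|`) with `α = a + j e`,
`2 ≤ j ≤ ℓ − 1` — the hole is not an end term (else `A` would be a progression), and if it is the
second term the progression is read backwards. [cite: Grynkiewicz2009, Lemma 5.10 (proof, «By
translating and considering −A and −B if necessary, we may w.l.o.g. assume 0, d ∈ A, and that 0 is
the first term of the minimal arithmetic progression with difference d containing A»)] -/
theorem exists_oneHole_normal_form {A : Finset G} {d α : G} (hαA : α ∉ A)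
    (hAP : IsAP (insert α A) d) (hnot : ¬ IsAP A d) (h3 : 3 ≤ #A) :
    ∃ e a : G, ∃ j : ℕ, (e = d ∨ e = -d) ∧ 2 ≤ j ∧ j + 1 ≤ #A ∧
      insert α A = apFinset a e (#A + 1) ∧ α = a + j • e := by
  obtain ⟨a, ha⟩ := hAP
  rw [card_insert_of_notMem hαA] at ha
  have hcard : #(apFinset a d (#A + 1)) = #A + 1 := by rw [← ha, card_insert_of_notMem hαA]
  have hαmem : α ∈ apFinset a d (#A + 1) := by rw [← ha]; exact mem_insert_self α A
  obtain ⟨j, hj, hjα⟩ := mem_apFinset.1 hαmem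
  have hAeq : A = (apFinset a d (#A + 1)).erase α := by rw [← ha, erase_insert hαA]
  have hj0 : j ≠ 0 := by
    rintro rfl
    rw [zero_nsmul, add_zero] at hjα
    rw [← hjα, erase_apFinset_first a d hcard] at hAeq
    exact hnot ⟨a + d, by rw [← hAeq]⟩
  have hjℓ : j ≠ #A := by
    rintro rfl
    rw [← hjα, erase_apFinset_last a d hcard] at hAeq
    exact hnot ⟨a, by rw [← hAeq]⟩
  by_cases hj2 : 2 ≤ j
  · exact ⟨d, a, j, Or.inl rfl, hj2, by omega, ha, hjα.symm⟩
  · have hj1 : j = 1 := by omega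
    subst hj1
    refine ⟨-d, a + #A • d, #A - 1, Or.inr rfl, by omega, by omega, ?_, ?_⟩
    · rw [ha, Isoperimetric.apFinset_eq_apFinset_neg a d (by omega), Nat.add_sub_cancel]
    · rw [← hjα, one_nsmul, neg_nsmul]
      have : #A • d = (#A - 1) • d + d := by rw [← succ_nsmul, Nat.sub_add_cancel (by omega)]
      rw [this]; abel

/-- **«Hence, `c_d(A) = 2`»**: the one-hole progression `{0, e, …, ℓ e} ∖ {j e}` (`1 ≤ j ≤ ℓ − 1`,
`ℓ + 2 ≤ |G|`, `⟨e⟩ = G`) has two aperiodic `e`-components: `A + {0, e} = {0, e, …, (ℓ + 1) e}`.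
[cite: Grynkiewicz2009, Lemma 5.10 (proof)] -/
theorem componentCount_oneHole [Fintype G] {A : Finset G} {e : G} {ℓ j : ℕ}
    (he : AddSubgroup.zmultiples e = ⊤) (hA : A = (apFinset (0 : G) e (ℓ + 1)).erase (j • e))
    (hj : 1 ≤ j) (hjℓ : j + 1 ≤ ℓ) (hℓ : ℓ + 2 ≤ Fintype.card G) : componentCount e A = 2 := by
  have hord : addOrderOf e = Fintype.card G :=
    Isoperimetric.addOrderOf_eq_card_of_zmultiples_eq_top he
  have hcardP : #(apFinset (0 : G) e (ℓ + 1)) = ℓ + 1 :=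
    card_apFinset_of_addOrderOf 0 e (Or.inr (by omega))
  have hjmem : j • e ∈ apFinset (0 : G) e (ℓ + 1) := mem_apFinset.2 ⟨j, by omega, zero_add _⟩
  have hcardA : #A = ℓ := by rw [hA, card_erase_of_mem hjmem, hcardP]; rfl
  have hmem : ∀ k, k ≤ ℓ → k ≠ j → k • e ∈ A := fun k hk hkj =>
    nsmul_mem_oneHole he hA (by omega) (by omega) hk hkj
  -- `A + {0, e} = {0, e, …, (ℓ+1) e}`
  have hsub : A + {0, e} ⊆ apFinset (0 : G) e (ℓ + 2) := by
    have h1 : A ⊆ apFinset (0 : G) e (ℓ + 1) := by rw [hA]; exact erase_subset _ _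
    have h2 : ({0, e} : Finset G) = apFinset (0 : G) e 2 := by
      ext x
      rw [mem_insert, mem_singleton, mem_apFinset]
      constructor
      · rintro (rfl | rfl)
        · exact ⟨0, by omega, by rw [zero_nsmul, add_zero]⟩
        · exact ⟨1, by omega, by rw [one_nsmul, zero_add]⟩
      · rintro ⟨i, hi, rfl⟩
        interval_cases i
        · left; rw [zero_nsmul, add_zero]
        · right; rw [one_nsmul, zero_add]
    rw [h2]
    refine (add_subset_add h1 Subset.rfl).trans ?_
    have := apFinset_add_apFinset_subset (0 : G) 0 e (ℓ + 1) 2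
    rwa [add_zero, show ℓ + 1 + 2 - 1 = ℓ + 2 by omega] at this
  have hsup : apFinset (0 : G) e (ℓ + 2) ⊆ A + {0, e} := by
    intro x hx
    obtain ⟨k, hk, rfl⟩ := mem_apFinset.1 hx
    rw [zero_add, add_pair_zero_eq_union, mem_union, mem_vadd_finset]
    by_cases hkj : k = j
    · right
      refine ⟨(j - 1) • e, hmem (j - 1) (by omega) (by omega), ?_⟩
      rw [hkj, vadd_eq_add, ← succ_nsmul', Nat.sub_add_cancel hj]
    by_cases hkℓ : k ≤ ℓ
    · exact Or.inl (hmem k hkℓ hkj)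
    · right
      refine ⟨ℓ • e, hmem ℓ le_rfl (by omega), ?_⟩
      rw [vadd_eq_add, ← succ_nsmul', show ℓ + 1 = k by omega]
  have heq : A + {0, e} = apFinset (0 : G) e (ℓ + 2) := Subset.antisymm hsub hsup
  rw [componentCount, heq, card_apFinset_of_addOrderOf 0 e (Or.inr (by omega)), hcardA]
  omega

/-- **«since `⟨A⟩ = G`, it follows that `⟨d⟩ = G`»**: a generating set containing `0` inside a
progression with difference `d` forces `⟨d⟩ = G`. [cite: Grynkiewicz2009, Lemma 5.10 (proof)] -/
theorem zmultiples_eq_top_of_subset_apFinset {A : Finset G} {a d : G} {n : ℕ}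
    (hA : A ⊆ apFinset a d n) (h0 : (0 : G) ∈ A) (hgen : AddSubgroup.closure (A : Set G) = ⊤) :
    AddSubgroup.zmultiples d = ⊤ := by
  obtain ⟨i, -, hi⟩ := mem_apFinset.1 (hA h0)
  have ha : a ∈ AddSubgroup.zmultiples d := by
    have : a = -(i • d) := eq_neg_of_add_eq_zero_left hi
    rw [this]
    exact AddSubgroup.neg_mem _ (AddSubgroup.nsmul_mem _ (AddSubgroup.mem_zmultiples d) i)
  rw [← top_le_iff, ← hgen, AddSubgroup.closure_le]
  intro x hx
  obtain ⟨k, -, rfl⟩ := mem_apFinset.1 (hA (mem_coe.1 hx))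
  exact AddSubgroup.add_mem _ ha (AddSubgroup.nsmul_mem _ (AddSubgroup.mem_zmultiples d) k)

/-- **An aperiodic progression is a quasi-progression**: if `B` is an arithmetic progression with
difference `e ≠ 0`, `B ≠ ∅`, and `B` is aperiodic (`H(B) = 0`), then `c_e(B) = 1`, i.e.
`B ∈ 𝒬𝒜𝒫_e` (`d⊆(B, 𝒜𝒫) = 0` gives `d⊆(B, 𝒬𝒜𝒫_{d'}) = 0` for the difference `d'` of `B`).
[cite: Grynkiewicz2009, §2 («A quasi-progression … note that any arithmetic progression … »); Lemma
5.10 (statement)] -/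
theorem isQuasiProgression_of_isAP {B : Finset G} {e : G} (hB : IsAP B e) (hne : B.Nonempty)
    (hstab : B.addStab = {0}) (he : e ≠ 0) : IsQuasiProgression e B := by
  obtain ⟨b, hb⟩ := hB
  have hpos : 1 ≤ #B := card_pos.2 hne
  have hsub : B ⊆ apFinset b e (#B + 1) := by
    rw [apFinset_succ_eq_union b e hpos, ← hb]; exact subset_union_left
  have hcard : #(apFinset b e (#B + 1)) = #B + 1 := by
    refine le_antisymm (card_apFinset_le _ _ _) ?_
    by_contra hlt
    push Not at hlt
    have heq : apFinset b e (#B + 1) = B := (eq_of_subset_of_card_le hsub (by omega)).symm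
    have hinv : e +ᵥ B ⊆ B := by
      intro x hx
      rw [← heq, apFinset_succ_eq_union b e hpos, ← hb]
      exact mem_union_right _ hx
    have hinv' : e +ᵥ B = B := eq_of_subset_of_card_le hinv (by rw [card_vadd_finset])
    have : e ∈ B.addStab := (mem_addStab hne).2 hinv'
    rw [hstab, mem_singleton] at this
    exact he this
  have := isQuasiProgression_apFinset (s := b) (d := e) hpos hcard
  rwa [← hb] at this

/-! ### Lemma 5.10 -/

/-- **Grynkiewicz 2009, Lemma 5.10** (arXiv:0710.1041v2 Lemma 4.14).  «Let `A` and `B` be nonempty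
subsets of a finite abelian group `G` with `|A + B| = |A| + |B|`, `0 ∈ A ∩ B`,
`|A|, |B|, d⊆(A + B, 𝒫) ≥ 3`, and `(A, B)` non-extendible, `⟨A⟩ = G` and `A` not quasi-periodic.
If `d⊆(A, 𝒜𝒫_d) = 1` for some nonzero `d ∈ G`, and if at most one of `|A|`, `|B|` and
`|\overline{A + B}|` is equal to `3`, then (17) holds and one of `d⊆(B, 𝒬𝒜𝒫_d) ≤ 1` or
`d⊆(B, 𝒬𝒜𝒫_{d'}) = 0`, for some non-zero `d'`, or `d⊆(C, 𝒬𝒫) = 1`, for all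
`C ∈ {A, B, A + B, Ā, B̄, \overline{A + B}}`, also holds.»  Conventions and the form of the
hypothesis «at most one … is equal to `3`» (only `|A| = 3 ⟹ |\overline{A + B}| ≠ 3` is used): see
the module docstring.  PROOF as printed, see the module docstring.
[cite: Grynkiewicz2009, Lemma 5.10] -/
theorem seventeen_of_subsetDist_isAP_eq_one [Fintype G] {A B : Finset G} {d : G}
    (hA3 : 3 ≤ #A) (hB3 : 3 ≤ #B) (h0A : (0 : G) ∈ A) (h0B : (0 : G) ∈ B)
    (hAB : #(A + B) = #A + #B)
    (hP3 : ∀ P : Finset G, A + B ⊆ P → P.addStab ≠ {0} → 3 ≤ #(P \ (A + B)))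
    (hneA : IsNonExtendible A B) (hneB : IsNonExtendible B A)
    (hgen : AddSubgroup.closure (A : Set G) = ⊤) (hAqp : ¬ IsQuasiPeriodic A)
    (hd : d ≠ 0) (hdA : subsetDist A {P | IsAP P d} = 1) (h33 : #A = 3 → #(A + B)ᶜ ≠ 3) :
    (∃ α β : G, #(insert α A + insert β B) + 1 = #(insert α A) + #(insert β B)) ∧
      (subsetDist B {P | IsQuasiProgression d P} ≤ 1 ∨
        (∃ d', d' ≠ 0 ∧ subsetDist B {P | IsQuasiProgression d' P} = 0) ∨
        ∀ C ∈ ({A, B, A + B, Aᶜ, Bᶜ, (A + B)ᶜ} : Finset (Finset G)),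
          subsetDist C {P | IsQuasiPeriodic P} = 1) := by
  classical
  set n := Fintype.card G with hn
  have hAne : A.Nonempty := ⟨0, h0A⟩
  have hBne : B.Nonempty := ⟨0, h0B⟩
  -- `A + B` is aperiodic, `|\overline{A + B}| ≥ 3`, `B` aperiodic
  have haper : (A + B).addStab = {0} := by
    by_contra hne
    have := hP3 (A + B) Subset.rfl hne
    rw [Finset.sdiff_self, card_empty] at this
    omega
  have hC3 : 3 ≤ #(A + B)ᶜ := by
    have hst : (univ : Finset G).addStab ≠ {0} := by
      intro heq
      have : d ∈ (univ : Finset G).addStab := (mem_addStab univ_nonempty).2 vadd_finset_univ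
      rw [heq, mem_singleton] at this
      exact hd this
    have := hP3 univ (subset_univ _) hst
    rwa [← compl_eq_univ_sdiff] at this
  have hcardC : #(A + B)ᶜ + #(A + B) = n := by
    have := card_le_univ (A + B); rw [card_compl]; omega
  have hBstab : B.addStab = {0} := by
    apply Subset.antisymm
    · rw [← haper]; exact subset_addStab_add_right hAne
    · rw [singleton_subset_iff]; exact hBne.zero_mem_addStab
  have hBuniv : B ≠ univ := by
    intro hBu
    have h1 : #(A + B) ≤ n := card_le_univ _
    rw [hAB, hBu, card_univ] at h1
    omega
  -- the one-hole shape of `A`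
  obtain ⟨hnotAP, α, hαA, hαAP⟩ := subsetDist_eq_one_iff.1 hdA
  rw [Set.mem_setOf_eq] at hnotAP hαAP
  obtain ⟨e, a, j, he, hj2, hjℓ, hinsA, hαeq⟩ := exists_oneHole_normal_form hαA hαAP hnotAP hA3
  -- `⟨d⟩ = G`, `⟨e⟩ = G`
  obtain ⟨a₀, ha₀⟩ := hαAP
  have hzm : AddSubgroup.zmultiples d = ⊤ :=
    zmultiples_eq_top_of_subset_apFinset (by rw [← ha₀]; exact subset_insert α A) h0A hgen
  have hze : AddSubgroup.zmultiples e = ⊤ := by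
    rcases he with rfl | rfl
    · exact hzm
    · rwa [AddSubgroup.zmultiples_neg]
  have horde : addOrderOf e = n := Isoperimetric.addOrderOf_eq_card_of_zmultiples_eq_top hze
  have hce : ∀ X : Finset G, componentCount e X = componentCount d X := fun X => by
    rcases he with rfl | rfl
    · rfl
    · exact componentCount_neg_left d X
  -- the normalised set `A₀ = −a + A = {0, e, …, ℓ e} ∖ {j e}`
  have hAerase : A = (apFinset a e (#A + 1)).erase (a + j • e) := by
    rw [← hαeq, ← hinsA, erase_insert hαA]
  have hA₀ : (-a) +ᵥ A = (apFinset (0 : G) e (#A + 1)).erase (j • e) := by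
    rw [hAerase, neg_vadd_erase_apFinset, card_erase_of_mem, card_apFinset_of_addOrderOf a e
      (Or.inr (by rw [horde]; omega))]
    · rfl
    · exact mem_apFinset.2 ⟨j, by omega, rfl⟩
  have hA₀B : ((-a) +ᵥ A) + B = (-a) +ᵥ (A + B) := vadd_add_assoc _ _ _
  have hcardA₀B : #(((-a) +ᵥ A) + B) = #A + #B := by rw [hA₀B, card_vadd_finset, hAB]
  have hsmall : #(((-a) +ᵥ A) + B) + 3 ≤ n := by rw [hcardA₀B, ← hAB]; omega
  have hℓn : #A < n := by omega
  -- Lemma 5.8 for a progression `B`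
  have finishAP : ∀ {f : G}, IsAP B f →
      ∃ α β : G, #(insert α A + insert β B) + 1 = #(insert α A) + #(insert β B) := by
    intro f hBf
    have hBA : #(B + A) = #B + #A := by rw [add_comm, hAB, add_comm]
    obtain ⟨-, -, β, α', h17⟩ :=
      subsetDist_quasiProgression_of_isAP (A := B) (B := A) hBA hB3 (by rwa [add_comm]) hBf
    refine ⟨α', β, ?_⟩
    rw [add_comm (insert α' A), h17, add_comm]
  -- `c_d(B) = 0` is impossible, `c_d(B) = 1` makes `B` a progression
  have hc0 : componentCount d B ≠ 0 := by
    intro h0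
    have hinv := componentCount_eq_zero_iff.1 h0
    have : d ∈ B.addStab := (mem_addStab hBne).2 hinv
    rw [hBstab, mem_singleton] at this
    exact hd this
  by_cases hc1 : componentCount d B = 1
  · obtain ⟨s, hs⟩ :=
      Isoperimetric.exists_eq_apFinset_of_card_vadd_sdiff_le_one_of_zmultiples_eq_top hzm hBuniv
        (by rw [← componentCount_eq_card_vadd_sdiff, hc1])
    exact ⟨finishAP ⟨s, hs⟩, Or.inl (by rw [subsetDist_eq_zero_iff.2 (show B ∈ _ from hc1)]; exact zero_le_one)⟩
  -- the case `c_d(B) = 2`: the counting core, translated back by `a`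
  have key2 : componentCount d B = 2 →
      (∃ α β : G, #(insert α A + insert β B) + 1 = #(insert α A) + #(insert β B)) ∧
      (subsetDist B {P | IsQuasiProgression d P} ≤ 1 ∨
        (∃ d', d' ≠ 0 ∧ subsetDist B {P | IsQuasiProgression d' P} = 0) ∨
        ∀ C ∈ ({A, B, A + B, Aᶜ, Bᶜ, (A + B)ᶜ} : Finset (Finset G)),
          subsetDist C {P | IsQuasiPeriodic P} = 1) := fun hc2 => by
    obtain ⟨β, hβB, -, hqp, hcard⟩ := oneHole_two_gaps hze hA₀ hj2 hjℓ hB3 hcardA₀B hsmall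
      (by rw [hce]; exact hc2)
    refine ⟨⟨α, β, ?_⟩, Or.inl (le_of_eq (subsetDist_eq_one ?_ hβB ?_))⟩
    · have h1 : insert α A + insert β B = a +ᵥ (apFinset (0 : G) e (#A + 1) + insert β B) := by
        rw [hinsA, ← vadd_add_assoc, vadd_apFinset, add_zero]
      rw [h1, card_vadd_finset, hcard, hinsA,
        card_apFinset_of_addOrderOf a e (Or.inr (by rw [horde]; omega)), card_insert_of_notMem hβB]
      omega
    · rw [Set.mem_setOf_eq, IsQuasiProgression, hc2]; omega
    · rw [Set.mem_setOf_eq, IsQuasiProgression, ← hce]; exact hqp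
  by_cases hA3' : #A = 3
  · -- `|A| = 3`: `c ≤ 3`, and `c = 3` is impossible
    have hj : j = 2 := by omega
    subst hj
    rw [hA3'] at hA₀ hcardA₀B
    have hc3 : componentCount d B ≤ 3 := by
      obtain ⟨-, hS⟩ := card_add_sdiff_of_oneHole (B := B) hze hA₀ (by omega) (by omega) (by omega)
      have := componentCount_le_of_oneHole (B := B) hze hA₀ (by omega) le_rfl (by omega)
      rw [hce] at this
      omega
    rcases Nat.lt_or_ge (componentCount d B) 3 with hlt | hge
    · exact key2 (by omega)
    · exfalso
      refine oneHole_three_gaps hze hA₀ hcardA₀B ?_ (by rw [hce]; omega)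
      have := h33 hA3'
      omega
  · -- `|A| ≥ 4`: Lemma 5.9 gives `c ≤ 2`, else the proof is complete
    have hcA : componentCount d A = 2 := by
      rw [← hce, ← componentCount_vadd e (-a) A, hA₀]
      exact componentCount_oneHole hze rfl (by omega) hjℓ (by omega)
    rcases componentCount_le_two_or_seventeen_of_componentCount_eq_two (by omega) hB3 h0A h0B hAB
        hP3 hneA hneB hgen hAqp hd hcA with ⟨hcB, -⟩ | ⟨h17, hor⟩
    · exact key2 (by omega)
    · refine ⟨h17, ?_⟩
      rcases hor with hsix | hBAP
      · exact Or.inr (Or.inr hsix)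
      · rw [subsetDist_eq_zero_iff, Set.mem_setOf_eq] at hBAP
        obtain ⟨e', he', hBe'⟩ := hBAP
        exact Or.inr (Or.inl ⟨e', he', subsetDist_eq_zero_iff.2
          (isQuasiProgression_of_isAP hBe' hBne hBstab he')⟩)


/-! ### §6, display (50): `d⊆(A, 𝒬𝒜𝒫_d) ≤ 1` completes the proof -/

section SubsetDistLe

variable {α : Type*} [DecidableEq α]

omit [AddCommGroup G] [DecidableEq G] in
/-- `d⊆(A, 𝒮) ≤ k` (`k` finite) unfolded: some `B ∈ 𝒮` contains `A` with `|B ∖ A| ≤ k`.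
[cite: Grynkiewicz2009, §1] -/
theorem exists_of_subsetDist_le {A : Finset α} {𝒮 : Set (Finset α)} {k : ℕ}
    (h : subsetDist A 𝒮 ≤ k) : ∃ B ∈ 𝒮, A ⊆ B ∧ #(B \ A) ≤ k := by
  have hlt : subsetDist A 𝒮 < (k + 1 : ℕ) :=
    lt_of_le_of_lt h (by exact_mod_cast Nat.lt_succ_self k)
  unfold subsetDist at hlt
  simp only [iInf_lt_iff] at hlt
  obtain ⟨B, hB, hAB, hcard⟩ := hlt
  refine ⟨B, hB, hAB, ?_⟩
  have : #(B \ A) < k + 1 := by exact_mod_cast hcard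
  omega

end SubsetDistLe

/-- **«If `d⊆(A, 𝒬𝒜𝒫_d) ≤ 1`, then `d⊆(A, 𝒬𝒫) ≥ 2` implies that `d⊆(A, 𝒜𝒫) ≤ 1`»** (print p. 28,
before display (50)), in the sharper form `d⊆(A, 𝒜𝒫_d) ≤ 1`: a quasi-progression `P ⊇ A` with
`|P ∖ A| ≤ 1` has empty periodic part (else `P` is quasi-periodic and `d⊆(A, 𝒬𝒫) ≤ 1`), so it is an
arithmetic progression with difference `d` (`IsQuasiProgression.exists_isQuasiPeriodicDecomp`); finite
`G`. [cite: Grynkiewicz2009, §6 (proof of Thm 4.1, display (50))] -/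
theorem subsetDist_isAP_le_one_of_quasiProgression [Fintype G] {A : Finset G} {d : G}
    (hq : subsetDist A {P | IsQuasiProgression d P} ≤ 1)
    (hQP : 2 ≤ subsetDist A {P | IsQuasiPeriodic P}) : subsetDist A {P | IsAP P d} ≤ 1 := by
  obtain ⟨P, hP, hAP, hcard⟩ := exists_of_subsetDist_le (k := 1) hq
  rw [Set.mem_setOf_eq] at hP
  obtain ⟨P₁, P₀, hdec, hP₀, hP₀ne⟩ := hP.exists_isQuasiPeriodicDecomp
  rcases P₁.eq_empty_or_nonempty with hP₁ | hP₁
  · have hPeq : P = P₀ := by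
      have := hdec.union_eq
      rw [hP₁, empty_union] at this
      exact this.symm
    rw [hPeq] at hAP hcard
    exact (subsetDist_le (show P₀ ∈ {P | IsAP P d} from hP₀) hAP).trans (by exact_mod_cast hcard)
  · exfalso
    have hqp : IsQuasiPeriodic P := ⟨_, P₁, P₀, hdec, hP₁⟩
    have h1 := (subsetDist_le (show P ∈ {P | IsQuasiPeriodic P} from hqp) hAP).trans
      (show ((#(P \ A) : ℕ) : ℕ∞) ≤ 1 by exact_mod_cast hcard)
    have h2 := hQP.trans h1
    exact absurd h2 (by exact_mod_cast (by norm_num : ¬ (2 : ℕ) ≤ 1))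

/-- **§6, display (50): `d⊆(A, 𝒬𝒜𝒫_d) ≤ 1` completes the proof.**  «If `d⊆(A, 𝒬𝒜𝒫_d) ≤ 1`, then
`d⊆(A, 𝒬𝒫) ≥ 2` (eq. (47)) implies that `d⊆(A, 𝒜𝒫) ≤ 1`. Likewise for `B`. Thus in view of
Lemmas 5.8 and 5.10 … it follows that (50) `d⊆(A, 𝒬𝒜𝒫_d), d⊆(B, 𝒬𝒜𝒫_d) ≥ 2` for all nonzero `d ∈ G`,
else the proof is complete»: under the standing hypotheses of §6 at that point (`|A|, |B| ≥ 3`,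
`0 ∈ A ∩ B`, `|A + B| = |A| + |B|`, `d⊆(A + B, 𝒫) ≥ 3`, `(A, B)` non-extendible, `⟨A⟩ = G`,
`d⊆(A, 𝒬𝒫) ≥ 2`, at most one of `|A|`, `|\overline{A + B}|` equal to `3`), `d⊆(A, 𝒬𝒜𝒫_d) ≤ 1` for a
nonzero `d` gives (17) — by Lemma 5.8 (`subsetDist_quasiProgression_of_isAP`) when `A` is a
progression, by Lemma 5.10 (`seventeen_of_subsetDist_isAP_eq_one`) when `d⊆(A, 𝒜𝒫_d) = 1`.
[cite: Grynkiewicz2009, §6 (proof of Thm 4.1, display (50))] -/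
theorem seventeen_of_subsetDist_quasiProgression_le_one [Fintype G] {A B : Finset G} {d : G}
    (hA3 : 3 ≤ #A) (hB3 : 3 ≤ #B) (h0A : (0 : G) ∈ A) (h0B : (0 : G) ∈ B)
    (hAB : #(A + B) = #A + #B)
    (hP3 : ∀ P : Finset G, A + B ⊆ P → P.addStab ≠ {0} → 3 ≤ #(P \ (A + B)))
    (hneA : IsNonExtendible A B) (hneB : IsNonExtendible B A)
    (hgen : AddSubgroup.closure (A : Set G) = ⊤)
    (hQP : 2 ≤ subsetDist A {P | IsQuasiPeriodic P}) (hd : d ≠ 0)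
    (hq : subsetDist A {P | IsQuasiProgression d P} ≤ 1) (h33 : #A = 3 → #(A + B)ᶜ ≠ 3) :
    ∃ α β : G, #(insert α A + insert β B) + 1 = #(insert α A) + #(insert β B) := by
  have hAqp : ¬ IsQuasiPeriodic A := fun hA => by
    have h0 := subsetDist_eq_zero_iff.2 (show A ∈ {P | IsQuasiPeriodic P} from hA)
    rw [h0] at hQP
    exact absurd hQP (by exact_mod_cast (by norm_num : ¬ (2 : ℕ) ≤ 0))
  have hAP := subsetDist_isAP_le_one_of_quasiProgression hq hQP
  rcases eq_or_lt_of_le hAP with h1 | h1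
  · exact (seventeen_of_subsetDist_isAP_eq_one hA3 hB3 h0A h0B hAB hP3 hneA hneB hgen hAqp hd h1
      h33).1
  · have h0 : subsetDist A {P | IsAP P d} = 0 := Order.lt_one_iff.1 h1
    have hAd : IsAP A d := subsetDist_eq_zero_iff.1 h0
    have haper : (A + B).addStab = {0} := by
      by_contra hne
      have := hP3 (A + B) Subset.rfl hne
      rw [Finset.sdiff_self, card_empty] at this
      omega
    exact (subsetDist_quasiProgression_of_isAP hAB hA3 haper hAd).2.2

end Grynkiewicz2009

end Literature.Combinatorics.Additive
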